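import Summits.AtomisticToContinuum.Crystallization.Theses.IsometryAtoms
import Summits.AtomisticToContinuum.Crystallization.Theses.PalmUnimodularRigidity
import Summits.AtomisticToContinuum.Crystallization.Theorems.PalmUnimodularRigidityCruxesToPalmRigidity
import Summits.AtomisticToContinuum.Crystallization.Theorems.PalmUnimodularRigidityShellsToBarlowChart
import Summits.AtomisticToContinuum.Crystallization.Theorems.PalmUnimodularRigidityLayeredLawsSelectHcpUniqueMinimiser
import Summits.AtomisticToContinuum.Crystallization.Theorems.ExcessDecayLiouvilleCoarseGrainsHcpEnergySeries
import Summits.AtomisticToContinuum.Crystallization.Theorems.PalmUnimodularRigidityCrysPeriodicBddBelow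
import Summits.AtomisticToContinuum.Crystallization.Theorems.PalmUnimodularRigidityPalmToHinge
import Summits.AtomisticToContinuum.Crystallization.Theorems.SquareWellLayerCakeTwelveWithinOne

/-!
# Split of the crux `IsometryAtoms.MinimisingLawsHaveAtoms` (PURITY, stmt-AtomisticToContinuum-15776)
# into the two open Palm cruxes of route `PalmUnimodularRigidity`

`MinimisingLawsHaveAtoms_of_subs : MinimiserShells → LayeredLawsSelectHcp → MinimisingLawsHaveAtoms`
(sorry-free): the typed decomposition of the rank-2 crux of route `IsometryAtoms` into

* `PalmUnimodularRigidity.MinimiserShells` (stmt-AtomisticToContinuum-9225; a.s. the root of a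
  minimising point-stationary hard-core law has a (1/100)-close-packed twelve-shell), and
* `PalmUnimodularRigidity.LayeredLawsSelectHcp` (stmt-AtomisticToContinuum-9226; an a.s. everywhere
  close-packed, Barlow-charted minimising law is a.s. an exact rotated relaxed hcp crystal with optimal
  parameters),

through three landed theorems: `ShellsToBarlowChart_of` (stmt-9227), `cruxesToPalmRigidity_proof`
(stmt-9228: shells → chart → selection → `PalmRigidity`) and `tube_hcpE_unique_minimiser` (the global
minimiser of the hcp energy function is unique). The last one is what turns the sibling target
`PalmRigidity` (a.s. SOME optimal `(a, h)`, sample-dependent) into an ATOM (ONE rooted isometry class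
charged): pinning `e(hcp a h) = e*` makes `(a, h)` a global minimiser of `hcpE`
(landed: `hcpE_globalMin_of_energy_eq_eStar`, `hcpE_eq_energyPerParticle`), the minimiser is
unique, so almost every sample is `count|A(Y − 0)` for the SAME `Y = hcpStacking a₀ h₀` (`0 ∈ Y`), and
that class has outer measure `1 > 0` (`palmRigidity_implies_minimisingLawsHaveAtoms`).

The frame hypotheses of the two routes agree definitionally (`IsRootedHardCore`, `IsPointStationaryLaw`,
`rootEnergy` unfold to the sibling's inlined forms), so no transport lemma is needed.

Proof text = §2–§3 of the registered strategist line
`Cruxes/MinimisingLawsHaveAtoms/Lines/hcp_transfer.lean` (planner `cstrat-…-15776-b1`), landed here as a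
Theorems file so that the route-level split can cite it by name (`--glue-by`).
-/

noncomputable section

namespace Summit.AtomisticToContinuum.Crystallization.Theorems.IsometryAtomsMinimisingLawsHaveAtoms

open MeasureTheory Set
open Literature.MathematicalPhysics.StatisticalMechanics Literature.Probability.Process
open Summit.AtomisticToContinuum.Crystallization.Theses.IsometryAtoms (MinimisingLawsHaveAtoms)
open Summit.AtomisticToContinuum.Crystallization.Theses.PalmUnimodularRigidity
  (MinimiserShells LayeredLawsSelectHcp PalmRigidity ShellsToBarlowChart)
open Summit.AtomisticToContinuum.Crystallization.Theorems.PalmUnimodularRigidity.LayeredLawsSelectHcp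
  (hcpE hcpQ tube_hcpE_unique_minimiser)
open Summit.AtomisticToContinuum.Crystallization.Theorems.SquareWellLayerCakeTwelveWithinOne.Closing
  (hcpE_eq_energyPerParticle hcpE_globalMin_of_energy_eq_eStar)
open Summit.AtomisticToContinuum.Crystallization.Theorems.PalmUnimodularRigidity (zero_mem_hcpStacking)

/-! ## §1 Uniqueness of the optimal hcp parameters (pinning `hcpE_globalMin_of_energy_eq_eStar` and
`hcpE = e(hcp · ·)` are the landed lemmas of `SquareWellLayerCakeTwelveWithinOne.Closing`) -/

/-- **Optimal hcp parameters are unique** in the positive quadrant (`tube_hcpE_unique_minimiser` after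
pinning). [folklore] -/
theorem split_optimal_hcp_params_unique {a h a' h' : ℝ} (ha0 : 0 < a) (hh0 : 0 < h) (ha0' : 0 < a')
    (hh0' : 0 < h') (ha : a ≠ 0) (hh : h ≠ 0) (ha' : a' ≠ 0) (hh' : h' ≠ 0)
    (hE : (hcpPeriodicConfiguration ha hh).energyPerParticle lennardJones =
      ⨅ Q : PeriodicConfiguration 3, Q.energyPerParticle lennardJones)
    (hE' : (hcpPeriodicConfiguration ha' hh').energyPerParticle lennardJones =
      ⨅ Q : PeriodicConfiguration 3, Q.energyPerParticle lennardJones) :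
    a' = a ∧ h' = h := by
  refine tube_hcpE_unique_minimiser a h a' h' ha0 hh0 ha0' hh0'
    (hcpE_globalMin_of_energy_eq_eStar ha hh hE) ?_
  rw [hcpE_eq_energyPerParticle ha hh, hE, hcpE_eq_energyPerParticle ha' hh', hE']

/-! ## §2 The atom -/

/-- A probability (outer) measure charges a set containing almost every point (no measurability
needed: `1 = P univ ≤ P s + P sᶜ`). [folklore] -/
theorem split_measure_pos_of_ae_mem {α : Type*} [MeasurableSpace α] {P : Measure α}
    [IsProbabilityMeasure P] {s : Set α} (h : ∀ᵐ x ∂P, x ∈ s) : 0 < P s := by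
  have hc : P sᶜ = 0 := mem_ae_iff.1 h
  by_contra hs
  have hs0 : P s = 0 := nonpos_iff_eq_zero.1 (not_lt.1 hs)
  have h1 : P Set.univ ≤ 0 :=
    calc P Set.univ = P (s ∪ sᶜ) := by rw [Set.union_compl_self]
      _ ≤ P s + P sᶜ := measure_union_le _ _
      _ = 0 := by rw [hs0, hc, add_zero]
  have h2 : P Set.univ = 0 := nonpos_iff_eq_zero.1 h1
  rw [measure_univ] at h2
  exact one_ne_zero h2

/-- **An a.s.-hcp law charges ONE rooted class.** If almost every sample of a probability law `P` is a
rotated relaxed hcp crystal `count|A(hcpStacking a h)` with OPTIMAL parameters (the conclusion of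
`PalmRigidity` for `P`), then `P` charges the exact rooted isometry class of one set `Y`: the optimal
parameters are unique (`split_optimal_hcp_params_unique`), so almost every sample is `count|A(Y − 0)`
for the SAME `Y = hcpStacking a₀ h₀` (`0 ∈ Y`), and that class has outer measure `1 > 0`. [folklore] -/
theorem split_exists_charged_class_of_ae_hcp {P : Measure (Measure (EuclideanSpace ℝ (Fin 3)))}
    [IsProbabilityMeasure P]
    (hae : ∀ᵐ μ ∂P, (∃ a h : ℝ, ∃ ha : a ≠ 0, ∃ hh : h ≠ 0, 1 / 2 ≤ a ∧ a ≤ 2 ∧ 1 / 2 ≤ h ∧ h ≤ 2 ∧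
      ∃ A : EuclideanSpace ℝ (Fin 3) ≃ₗᵢ[ℝ] EuclideanSpace ℝ (Fin 3),
        (hcpPeriodicConfiguration ha hh).energyPerParticle lennardJones =
          (⨅ Q : PeriodicConfiguration 3, Q.energyPerParticle lennardJones) ∧
        μ = (Measure.count : Measure (EuclideanSpace ℝ (Fin 3))).restrict (A '' hcpStacking a h))) :
    ∃ Y : Set (EuclideanSpace ℝ (Fin 3)), 0 < P {μ | ∃ A : EuclideanSpace ℝ (Fin 3) →ₗᵢ[ℝ]
      EuclideanSpace ℝ (Fin 3), ∃ q ∈ Y, μ = (Measure.count : Measure (EuclideanSpace ℝ (Fin 3))).restrict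
        ((fun s => A (s - q)) '' Y)} := by
  obtain ⟨μ₀, hμ₀⟩ := hae.exists
  obtain ⟨a₀, h₀, ha₀, hh₀, ha₀l, -, hh₀l, -, A₀, hE₀, -⟩ := hμ₀
  have ha₀p : 0 < a₀ := by linarith
  have hh₀p : 0 < h₀ := by linarith
  refine ⟨hcpStacking a₀ h₀, split_measure_pos_of_ae_mem ?_⟩
  filter_upwards [hae] with μ hμ
  obtain ⟨a, h, ha, hh, hal, -, hhl, -, A, hE, rfl⟩ := hμ
  have hap : 0 < a := by linarith
  have hhp : 0 < h := by linarith
  obtain ⟨rfl, rfl⟩ := split_optimal_hcp_params_unique ha₀p hh₀p hap hhp ha₀ hh₀ ha hh hE₀ hE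
  refine ⟨A.toLinearIsometry, 0, zero_mem_hcpStacking a h, ?_⟩
  congr 1
  refine Set.image_congr' fun s => ?_
  simp

/-- **The sibling target gives PURITY**: `PalmRigidity → MinimisingLawsHaveAtoms`
(stmt-AtomisticToContinuum-9224 ⇒ stmt-AtomisticToContinuum-15776). The frame hypotheses of the two
routes agree definitionally. -/
theorem palmRigidity_implies_minimisingLawsHaveAtoms (hPalm : PalmRigidity) : MinimisingLawsHaveAtoms :=
  fun δ hδ P hP hcore hstat hmin =>
    haveI : IsProbabilityMeasure P := hP
    split_exists_charged_class_of_ae_hcp (hPalm δ hδ P hP hcore hstat hmin)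

/-! ## §3 The split -/

/-- **`MinimisingLawsHaveAtoms_of_subs`** — the typed decomposition of the crux: the two open Palm cruxes
`MinimiserShells` (stmt-9225) and `LayeredLawsSelectHcp` (stmt-9226) of route `PalmUnimodularRigidity`
give `IsometryAtoms.MinimisingLawsHaveAtoms` BY NAME — `cruxesToPalmRigidity_proof` (landed glue 9228)
fed with `ShellsToBarlowChart_of` (landed crux 9227) gives `PalmRigidity`, and
`palmRigidity_implies_minimisingLawsHaveAtoms` the atom. -/
theorem MinimisingLawsHaveAtoms_of_subs (h₁ : MinimiserShells) (h₂ : LayeredLawsSelectHcp) :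
    MinimisingLawsHaveAtoms :=
  palmRigidity_implies_minimisingLawsHaveAtoms
    (Summit.AtomisticToContinuum.Crystallization.Theorems.PalmUnimodularRigidity.cruxesToPalmRigidity_proof
      h₁
      Summit.AtomisticToContinuum.Crystallization.Cruxes.ShellsToBarlowChart.DevelopTheModelGrowthDescent.ShellsToBarlowChart_of
      h₂)

end Summit.AtomisticToContinuum.Crystallization.Theorems.IsometryAtomsMinimisingLawsHaveAtoms

end
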